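import Summits.CriticalPhenomena.CardyFormulaZ2.Theorems.CardyUniqueLimitCardyRigidityConformalKit2
import Literature.Probability.RandomPlanarGeometry.PlusHullKoebe
import Mathlib.Analysis.Complex.Liouville
import Mathlib.Analysis.Calculus.Deriv.Inverse
import HarnessLib

/-!
# Conformal kit (K2 sequel, K3): the uniform modulus on `ℍ ∩ B̄(0, X)`, and Koebe's estimate in
the half-plane

Crux `Summit.CriticalPhenomena.CardyFormulaZ2.Theses.CardyUniqueLimit.CardyRigidity`
(stmt-CriticalPhenomena-0746), line `crossing_martingale`, helper kit for the heart
`stub_slitObservableApprox`; sequel of `…ConformalKit2.lean` (`exists_forall_dist_le_of_hlc`: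
uniform local connectedness of `ℂ ∖ U` ⇒ the near side `f(ℍ ∩ B(x, d))` of a conformal bijection
`f : ℍ → U` moving points by `≤ C₀` lies in an `η`-disc, at the Wolff scale `d`).

* `dist_le_of_hlc` — oscillation `≤ 2η` on `ℍ ∩ B(x, d)`; `exists_scale_lt_le` — the scale
  `d = d(C₀, ε₁, η) ∈ (0, 1)`;
* `norm_sub_le_of_le_im` — **interior Lipschitz bound** `‖f w - f w'‖ ≤ (1 + 8C₀/d) ‖w - w'‖` for
  `im w, im w' ≥ d/4` (Cauchy's estimate for the bounded holomorphic `f - id`, Mathlib's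
  `Complex.norm_deriv_le_of_forall_mem_sphere_norm_le`, and the mean value inequality);
* **`dist_le_of_hlc_of_dist_le`** — (K2) in the form asked for by the line: with
  `τ = min (d/4) (η d/(d + 8C₀))`, ALL `w, w' ∈ ℍ`, `‖w‖ ≤ X`, `dist w w' ≤ τ` have
  `dist (f w) (f w') ≤ 2η`, given uniform local connectedness at scale `(ε₁, η)` for boundary
  points in `B̄(0, X + 1 + C₀)`; `dist_le_of_hlc_of_continuousWithinAt` — the same for boundary
  values of any extension `F` of `f` continuous within `{im ≥ 0}` at the two points;
* (K3) **Koebe's one-quarter estimate in the half-plane**: `ball_subset_image_halfPlane`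
  (`B(f w, im w |f' w|/4) ⊆ f(ℍ)`, the tree's `koebeQuarter_holds` on the disc `B(w, im w) ⊆ ℍ`),
  `mul_norm_deriv_le_dist_of_not_mem` (`im w |f' w|/4 ≤ dist (f w) z` for `z ∉ f(ℍ)`), and the
  upper bound `infDist_le_mul_norm_deriv` (`dist (f w, ℂ ∖ U) ≤ 4 im w |f' w|`, Koebe for the
  inverse, which is holomorphic with `g' = 1/f'`): Pommerenke (1992), Cor. 1.4; Lawler (2005),
  Thm. 3.17, Cor. 3.19.

References: Ch. Pommerenke (1992), Cor. 1.4, Prop. 2.3 [PommerenkeBBCM1992]; G. F. Lawler (2005),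
Thm. 3.17, Cor. 3.19 [Lawler2008].
-/

noncomputable section

open Set Filter Metric MeasureTheory Real Bornology
open _root_.Complex _root_.Topology
open UpperHalfPlane (upperHalfPlaneSet isOpen_upperHalfPlaneSet)
open scoped ENNReal NNReal

namespace Summit.CriticalPhenomena.CardyFormulaZ2.Cruxes.CardyRigidity.CrossingMartingale

namespace ConformalKit

variable {U : Set ℂ} {f g : ℂ → ℂ} {C₀ : ℝ} {V : Set ℂ} {ε₁ η : ℝ}

/-! ### (K2) oscillation form and the scale -/

/-- The inverse `g` of a map `f : ℍ → U` moving points by at most `C₀` moves points by at most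
`C₀`. [folklore] -/
theorem norm_inv_sub_le (hgU : MapsTo g U upperHalfPlaneSet) (hfg : ∀ z ∈ U, f (g z) = z)
    (hC : ∀ w ∈ upperHalfPlaneSet, ‖f w - w‖ ≤ C₀) {z : ℂ} (hz : z ∈ U) : ‖g z - z‖ ≤ C₀ := by
  have h := hC (g z) (hgU hz)
  rwa [hfg z hz, norm_sub_rev] at h

/-- **(K2), oscillation form**: under the hypotheses of `exists_forall_dist_le_of_hlc`, `f`
oscillates by at most `2η` on `ℍ ∩ B(x, d)`. [cite: PommerenkeBBCM1992, Prop. 2.3] -/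
theorem dist_le_of_hlc (hf : DifferentiableOn ℂ f upperHalfPlaneSet)
    (hU : IsOpen U) (hfU : MapsTo f upperHalfPlaneSet U) (hgc : ContinuousOn g U)
    (hgU : MapsTo g U upperHalfPlaneSet) (hgf : ∀ w ∈ upperHalfPlaneSet, g (f w) = w)
    (hfg : ∀ z ∈ U, f (g z) = z) (hC₀ : 0 ≤ C₀) (hC : ∀ w ∈ upperHalfPlaneSet, ‖f w - w‖ ≤ C₀)
    (hlc : ∀ a ∈ frontier U, ∀ b ∈ frontier U, a ∈ V → b ∈ V → dist a b < ε₁ →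
      ∃ σ ⊆ Uᶜ, IsCompact σ ∧ IsPreconnected σ ∧ a ∈ σ ∧ b ∈ σ ∧ σ ⊆ closedBall a η)
    {d : ℝ} (hd : 0 < d) (hd1 : d < 1) (hε₁ : 4 * π * (1 + C₀) / √(Real.log (1 / d)) < ε₁)
    (hη : 4 * π * (1 + C₀) / √(Real.log (1 / d)) ≤ η) {x : ℝ}
    (hV : closedBall (x : ℂ) (1 + C₀) ⊆ V) {w w' : ℂ} (hw : w ∈ upperHalfPlaneSet)
    (hwd : dist w x < d) (hw' : w' ∈ upperHalfPlaneSet) (hw'd : dist w' x < d) :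
    dist (f w) (f w') ≤ 2 * η := by
  obtain ⟨a, -, ha⟩ := exists_forall_dist_le_of_hlc hf hU hfU hgc hgU hgf hfg hC₀ hC hlc hd hd1
    hε₁ hη hV
  calc dist (f w) (f w') ≤ dist (f w) a + dist (f w') a := dist_triangle_right _ _ _
    _ ≤ η + η := add_le_add (ha w hw hwd) (ha w' hw' hw'd)
    _ = 2 * η := by ring

/-- **The scale of (K2)**: for `C₀ ≥ 0`, `ε₁ > 0`, `η > 0` the radius
`d = exp (-(4π (1 + C₀)/min (ε₁/2) η)²) ∈ (0, 1)` has Wolff bound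
`4π (1 + C₀)/√(log (1/d)) = min (ε₁/2) η`, hence `< ε₁` and `≤ η`. [folklore] -/
theorem exists_scale_lt_le (hC₀ : 0 ≤ C₀) (hε₁ : 0 < ε₁) (hη : 0 < η) :
    ∃ d ∈ Ioo (0 : ℝ) 1, 4 * π * (1 + C₀) / √(Real.log (1 / d)) < ε₁ ∧
      4 * π * (1 + C₀) / √(Real.log (1 / d)) ≤ η := by
  set τ : ℝ := min (ε₁ / 2) η with hτ
  have hτ0 : 0 < τ := lt_min (by positivity) hη
  set M : ℝ := 4 * π * (1 + C₀) with hM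
  have hM0 : 0 < M := by positivity
  set d : ℝ := Real.exp (-(M / τ) ^ 2) with hddef
  have hsq : 0 < (M / τ) ^ 2 := by positivity
  have hd0 : 0 < d := Real.exp_pos _
  have hd1 : d < 1 := Real.exp_lt_one_iff.2 (by linarith)
  have hlog : Real.log (1 / d) = (M / τ) ^ 2 := by
    rw [one_div, Real.log_inv, hddef, Real.log_exp, neg_neg]
  have hval : M / √(Real.log (1 / d)) = τ := by
    rw [hlog, Real.sqrt_sq (by positivity)]
    field_simp
  refine ⟨d, ⟨hd0, hd1⟩, ?_, ?_⟩
  · rw [hval]; exact (min_le_left _ _).trans_lt (by linarith)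
  · rw [hval]; exact min_le_right _ _

/-! ### Interior Lipschitz bound from the displacement bound -/

/-- **Interior Lipschitz bound.** If `f` is holomorphic on `ℍ` with `‖f w - w‖ ≤ C₀`, then for
`im w, im w' ≥ d/4` (`d > 0`): `‖f w - f w'‖ ≤ (1 + 8C₀/d) ‖w - w'‖` (Cauchy's estimate
`‖(f - id)'‖ ≤ C₀/(d/8)` on `{im ≥ d/4}` and the mean value inequality on this convex set).
[folklore] -/
theorem norm_sub_le_of_le_im (hf : DifferentiableOn ℂ f upperHalfPlaneSet)
    (hC : ∀ w ∈ upperHalfPlaneSet, ‖f w - w‖ ≤ C₀) {d : ℝ} (hd : 0 < d) {w w' : ℂ}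
    (hw : d / 4 ≤ w.im) (hw' : d / 4 ≤ w'.im) :
    ‖f w - f w'‖ ≤ (1 + 8 * C₀ / d) * ‖w - w'‖ := by
  set h : ℂ → ℂ := fun z ↦ f z - z with hh
  set S : Set ℂ := {z : ℂ | d / 4 ≤ z.im} with hS
  have hSH : S ⊆ upperHalfPlaneSet := fun z hz ↦ show 0 < z.im by
    have : d / 4 ≤ z.im := hz
    linarith
  have hSconv : Convex ℝ S := by
    have : S = im ⁻¹' Ici (d / 4) := rfl
    rw [this]
    exact (convex_Ici _).linear_preimage imLm
  have hhd : DifferentiableOn ℂ h upperHalfPlaneSet := hf.sub differentiableOn_id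
  have hderiv : ∀ z ∈ S, ‖deriv h z‖ ≤ 8 * C₀ / d := by
    intro z hz
    have hzim : d / 4 ≤ z.im := hz
    have hsub : closedBall z (d / 8) ⊆ upperHalfPlaneSet := by
      intro u hu
      rw [mem_closedBall, dist_eq_norm] at hu
      have h1 := abs_im_le_norm (u - z)
      rw [sub_im] at h1
      show 0 < u.im
      linarith [(abs_le.1 (h1.trans hu)).1]
    have hdc : DiffContOnCl ℂ h (ball z (d / 8)) := hhd.diffContOnCl_ball hsub
    have hbound : ∀ u ∈ sphere z (d / 8), ‖h u‖ ≤ C₀ :=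
      fun u hu ↦ hC u (hsub (sphere_subset_closedBall hu))
    have := Complex.norm_deriv_le_of_forall_mem_sphere_norm_le (by positivity) hdc hbound
    calc ‖deriv h z‖ ≤ C₀ / (d / 8) := this
      _ = 8 * C₀ / d := by field_simp
  have hdiff : ∀ z ∈ S, DifferentiableAt ℂ h z := fun z hz ↦
    hhd.differentiableAt (isOpen_upperHalfPlaneSet.mem_nhds (hSH hz))
  have hmv := hSconv.norm_image_sub_le_of_norm_deriv_le hdiff hderiv hw' hw
  calc ‖f w - f w'‖ = ‖(h w - h w') + (w - w')‖ := by rw [hh]; ring_nf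
    _ ≤ ‖h w - h w'‖ + ‖w - w'‖ := norm_add_le _ _
    _ ≤ 8 * C₀ / d * ‖w - w'‖ + ‖w - w'‖ := by gcongr
    _ = (1 + 8 * C₀ / d) * ‖w - w'‖ := by ring

/-! ### (K2) as a uniform modulus of continuity on `ℍ ∩ B̄(0, X)` -/

/-- **(K2) Uniform local connectedness ⇒ uniform modulus of continuity of `f` on
`ℍ ∩ B̄(0, X)`.**  Let `f : ℍ → U` be a conformal bijection (open `U`, continuous inverse `g`,
`‖f w - w‖ ≤ C₀`), let `ℂ ∖ U` be uniformly locally connected at scale `(ε₁, η)` for boundary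
points in `B̄(0, X + 1 + C₀)`, and let `0 < d < 1` have Wolff bound `< ε₁` and `≤ η`
(`exists_scale_lt_le`).  Then with `τ = min (d/4) (η d/(d + 8C₀))`: all `w, w' ∈ ℍ` with
`‖w‖ ≤ X`, `dist w w' ≤ τ` have `dist (f w) (f w') ≤ 2η` (near `ℝ`: `dist_le_of_hlc` about
`x = re w`; away from `ℝ`: `norm_sub_le_of_le_im`). [cite: PommerenkeBBCM1992, Prop. 2.3] -/
theorem dist_le_of_hlc_of_dist_le (hf : DifferentiableOn ℂ f upperHalfPlaneSet)
    (hU : IsOpen U) (hfU : MapsTo f upperHalfPlaneSet U) (hgc : ContinuousOn g U)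
    (hgU : MapsTo g U upperHalfPlaneSet) (hgf : ∀ w ∈ upperHalfPlaneSet, g (f w) = w)
    (hfg : ∀ z ∈ U, f (g z) = z) (hC₀ : 0 ≤ C₀) (hC : ∀ w ∈ upperHalfPlaneSet, ‖f w - w‖ ≤ C₀)
    {X : ℝ} (hη0 : 0 ≤ η)
    (hlc : ∀ a ∈ frontier U, ∀ b ∈ frontier U, a ∈ closedBall (0 : ℂ) (X + 1 + C₀) →
      b ∈ closedBall (0 : ℂ) (X + 1 + C₀) → dist a b < ε₁ →
      ∃ σ ⊆ Uᶜ, IsCompact σ ∧ IsPreconnected σ ∧ a ∈ σ ∧ b ∈ σ ∧ σ ⊆ closedBall a η)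
    {d : ℝ} (hd : 0 < d) (hd1 : d < 1) (hε₁ : 4 * π * (1 + C₀) / √(Real.log (1 / d)) < ε₁)
    (hηd : 4 * π * (1 + C₀) / √(Real.log (1 / d)) ≤ η) {w w' : ℂ} (hw : w ∈ upperHalfPlaneSet)
    (hw' : w' ∈ upperHalfPlaneSet) (hwX : ‖w‖ ≤ X)
    (hdist : dist w w' ≤ min (d / 4) (η * d / (d + 8 * C₀))) :
    dist (f w) (f w') ≤ 2 * η := by
  have hτ1 : dist w w' ≤ d / 4 := hdist.trans (min_le_left _ _)
  have hτ2 : dist w w' ≤ η * d / (d + 8 * C₀) := hdist.trans (min_le_right _ _)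
  by_cases hcase : w.im < d / 2
  · -- near `ℝ`: both points lie in `B(re w, d)`
    set x : ℝ := w.re with hx
    have hwx : dist w x = w.im := by
      rw [dist_eq_norm, show w - (x : ℂ) = (w.im : ℝ) * I from by
        apply Complex.ext <;> simp [hx], norm_mul, Complex.norm_real, norm_I, mul_one,
        Real.norm_eq_abs, abs_of_pos hw]
    have hwd : dist w x < d := by rw [hwx]; linarith
    have hw'd : dist w' x < d := by
      calc dist w' (x : ℂ) ≤ dist w' w + dist w x := dist_triangle _ _ _
        _ < d / 4 + d / 2 := by rw [dist_comm, hwx]; exact add_lt_add_of_le_of_lt hτ1 hcase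
        _ ≤ d := by linarith
    have hV : closedBall (x : ℂ) (1 + C₀) ⊆ closedBall (0 : ℂ) (X + 1 + C₀) := by
      intro z hz
      rw [mem_closedBall, dist_zero_right] at *
      have hxX : ‖(x : ℂ)‖ ≤ X := by
        rw [Complex.norm_real, Real.norm_eq_abs, hx]; exact (abs_re_le_norm w).trans hwX
      calc ‖z‖ = ‖(z - x) + x‖ := by ring_nf
        _ ≤ ‖z - (x : ℂ)‖ + ‖(x : ℂ)‖ := norm_add_le _ _
        _ ≤ (1 + C₀) + X := add_le_add (by rwa [← dist_eq_norm]) hxX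
        _ = X + 1 + C₀ := by ring
    exact dist_le_of_hlc hf hU hfU hgc hgU hgf hfg hC₀ hC hlc hd hd1 hε₁ hηd hV hw hwd hw' hw'd
  · -- away from `ℝ`: the interior Lipschitz bound
    push Not at hcase
    have hw'im : d / 4 ≤ w'.im := by
      have h1 := abs_im_le_norm (w - w')
      rw [sub_im, ← dist_eq_norm] at h1
      linarith [(abs_le.1 (h1.trans hτ1)).2]
    have hwim : d / 4 ≤ w.im := by linarith
    have hlip := norm_sub_le_of_le_im hf hC hd hwim hw'im
    have hden : 0 < d + 8 * C₀ := by positivity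
    have hK : (1 + 8 * C₀ / d) * ‖w - w'‖ ≤ η := by
      rw [← dist_eq_norm]
      calc (1 + 8 * C₀ / d) * dist w w' ≤ (1 + 8 * C₀ / d) * (η * d / (d + 8 * C₀)) := by
            gcongr
        _ = η := by field_simp
    rw [dist_eq_norm]
    linarith

/-- **(K2) for boundary values.** Under the hypotheses of `dist_le_of_hlc_of_dist_le` with `X`
replaced by `X + 1` in `hlc`, any `F` agreeing with `f` on `ℍ` and continuous within `{im ≥ 0}` at
`w, w'` satisfies `dist (F w) (F w') ≤ 2η` for `w, w' ∈ {im ≥ 0}`, `‖w‖ ≤ X`,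
`dist w w' ≤ min (d/4) (η d/(d + 8C₀))` (approximate by `w + i/(n+1)`, `w' + i/(n+1)`).
[cite: PommerenkeBBCM1992, Prop. 2.3] -/
theorem dist_le_of_hlc_of_continuousWithinAt (hf : DifferentiableOn ℂ f upperHalfPlaneSet)
    (hU : IsOpen U) (hfU : MapsTo f upperHalfPlaneSet U) (hgc : ContinuousOn g U)
    (hgU : MapsTo g U upperHalfPlaneSet) (hgf : ∀ w ∈ upperHalfPlaneSet, g (f w) = w)
    (hfg : ∀ z ∈ U, f (g z) = z) (hC₀ : 0 ≤ C₀) (hC : ∀ w ∈ upperHalfPlaneSet, ‖f w - w‖ ≤ C₀)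
    {X : ℝ} (hη0 : 0 ≤ η)
    (hlc : ∀ a ∈ frontier U, ∀ b ∈ frontier U, a ∈ closedBall (0 : ℂ) (X + 1 + 1 + C₀) →
      b ∈ closedBall (0 : ℂ) (X + 1 + 1 + C₀) → dist a b < ε₁ →
      ∃ σ ⊆ Uᶜ, IsCompact σ ∧ IsPreconnected σ ∧ a ∈ σ ∧ b ∈ σ ∧ σ ⊆ closedBall a η)
    {d : ℝ} (hd : 0 < d) (hd1 : d < 1) (hε₁ : 4 * π * (1 + C₀) / √(Real.log (1 / d)) < ε₁)
    (hηd : 4 * π * (1 + C₀) / √(Real.log (1 / d)) ≤ η) {F : ℂ → ℂ}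
    (hFf : ∀ w ∈ upperHalfPlaneSet, F w = f w) {w w' : ℂ} (hw : 0 ≤ w.im) (hw' : 0 ≤ w'.im)
    (hFw : ContinuousWithinAt F {z : ℂ | 0 ≤ z.im} w)
    (hFw' : ContinuousWithinAt F {z : ℂ | 0 ≤ z.im} w') (hwX : ‖w‖ ≤ X)
    (hdist : dist w w' ≤ min (d / 4) (η * d / (d + 8 * C₀))) :
    dist (F w) (F w') ≤ 2 * η := by
  -- the approximating sequences
  set t : ℕ → ℝ := fun n ↦ 1 / ((n : ℝ) + 1) with ht
  have ht_pos : ∀ n, 0 < t n := fun n ↦ by rw [ht]; positivity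
  set e : ℕ → ℂ := fun n ↦ (t n : ℂ) * I with he
  have he_im : ∀ n, (e n).im = t n := fun n ↦ by simp only [he, mul_I_im, ofReal_re]
  have he_pos : ∀ n, 0 < (e n).im := fun n ↦ by rw [he_im]; exact ht_pos n
  have he_norm : ∀ n, ‖e n‖ ≤ 1 := fun n ↦ by
    have h1 : ‖e n‖ = t n := by
      simp only [he, norm_mul, norm_I, mul_one, Complex.norm_real, Real.norm_eq_abs,
        abs_of_pos (ht_pos n)]
    rw [h1, ht]
    exact (div_le_one (by positivity)).2 (by linarith [n.cast_nonneg (α := ℝ)])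
  have he0 : Tendsto e atTop (𝓝 0) := by
    have h1 : Tendsto t atTop (𝓝 0) := tendsto_one_div_add_atTop_nhds_zero_nat
    have h2 : Tendsto (fun n ↦ (t n : ℂ)) atTop (𝓝 ((0 : ℝ) : ℂ)) :=
      (Complex.continuous_ofReal.tendsto 0).comp h1
    have h3 := h2.mul_const I
    rw [ofReal_zero, zero_mul] at h3
    exact h3
  have hmem : ∀ (v : ℂ), 0 ≤ v.im → ∀ n, v + e n ∈ upperHalfPlaneSet := fun v hv n ↦ by
    show 0 < (v + e n).im
    rw [add_im]; linarith [he_pos n]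
  have hlimF : ∀ (v : ℂ), 0 ≤ v.im → ContinuousWithinAt F {z : ℂ | 0 ≤ z.im} v →
      Tendsto (fun n ↦ f (v + e n)) atTop (𝓝 (F v)) := by
    intro v hv hFv
    have h1 : Tendsto (fun n ↦ v + e n) atTop (𝓝[{z : ℂ | 0 ≤ z.im}] v) := by
      refine tendsto_nhdsWithin_iff.2 ⟨?_, Eventually.of_forall fun n ↦
        (show 0 < (v + e n).im from hmem v hv n).le⟩
      simpa using tendsto_const_nhds.add he0
    exact (hFv.tendsto.comp h1).congr fun n ↦ hFf _ (hmem v hv n)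
  have hlim : Tendsto (fun n ↦ dist (f (w + e n)) (f (w' + e n))) atTop
      (𝓝 (dist (F w) (F w'))) := (hlimF w hw hFw).dist (hlimF w' hw' hFw')
  refine le_of_tendsto hlim (Eventually.of_forall fun n ↦ ?_)
  have hwX' : ‖w + e n‖ ≤ X + 1 := (norm_add_le _ _).trans (add_le_add hwX (he_norm n))
  have hdist' : dist (w + e n) (w' + e n) ≤ min (d / 4) (η * d / (d + 8 * C₀)) := by
    rwa [dist_add_right]
  exact dist_le_of_hlc_of_dist_le hf hU hfU hgc hgU hgf hfg hC₀ hC hη0 hlc hd hd1 hε₁ hηd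
    (hmem w hw n) (hmem w' hw' n) hwX' hdist'

/-! ### (K3) Koebe's one-quarter estimate in the half-plane -/

/-- **Koebe's one-quarter theorem in the half-plane**: for `f` holomorphic and injective on `ℍ`
and `w ∈ ℍ`, `B(f w, im w · |f' w|/4) ⊆ f(ℍ)` (Koebe on the disc `B(w, im w) ⊆ ℍ`; the tree's
`ball_subset_image_of_injOn_ball`, Lawler (2005), Thm. 3.17). [cite: Lawler2008, Thm. 3.17 (p. 62)] -/
theorem ball_subset_image_halfPlane (hf : DifferentiableOn ℂ f upperHalfPlaneSet)
    (hinj : InjOn f upperHalfPlaneSet) {w : ℂ} (hw : w ∈ upperHalfPlaneSet) :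
    ball (f w) (w.im * ‖deriv f w‖ / 4) ⊆ f '' upperHalfPlaneSet := by
  have hwim : 0 < w.im := hw
  have hsub : ball w w.im ⊆ upperHalfPlaneSet := fun u hu ↦ by
    rw [mem_ball, dist_eq_norm] at hu
    have h1 := abs_im_le_norm (u - w)
    rw [sub_im] at h1
    show 0 < u.im
    linarith [(abs_lt.1 (h1.trans_lt hu)).1]
  exact (Literature.Probability.RandomPlanarGeometry.ball_subset_image_of_injOn_ball hwim
    (hf.mono hsub) (hinj.mono hsub)).trans (image_mono hsub)

/-- **Koebe lower bound for the distance to the boundary**: for `f` holomorphic and injective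
on `ℍ`, `w ∈ ℍ` and any `z ∉ f(ℍ)`: `im w · |f' w|/4 ≤ dist (f w) z`. [cite: Lawler2008, Thm. 3.17 (p. 62)] -/
theorem mul_norm_deriv_le_dist_of_not_mem (hf : DifferentiableOn ℂ f upperHalfPlaneSet)
    (hinj : InjOn f upperHalfPlaneSet) {w : ℂ} (hw : w ∈ upperHalfPlaneSet) {z : ℂ}
    (hz : z ∉ f '' upperHalfPlaneSet) : w.im * ‖deriv f w‖ / 4 ≤ dist (f w) z := by
  by_contra h
  rw [not_le] at h
  exact hz (ball_subset_image_halfPlane hf hinj hw (by rw [mem_ball, dist_comm]; exact h))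

/-- **Koebe lower bound, `infDist` form**: `im w · |f' w|/4 ≤ infDist (f w) (ℂ ∖ f(ℍ))` when the
complement is nonempty. [cite: Lawler2008, Thm. 3.17 (p. 62)] -/
theorem mul_norm_deriv_le_infDist (hf : DifferentiableOn ℂ f upperHalfPlaneSet)
    (hinj : InjOn f upperHalfPlaneSet) {w : ℂ} (hw : w ∈ upperHalfPlaneSet)
    (hne : (f '' upperHalfPlaneSet)ᶜ.Nonempty) :
    w.im * ‖deriv f w‖ / 4 ≤ infDist (f w) (f '' upperHalfPlaneSet)ᶜ :=
  (le_infDist hne).2 fun _ hz ↦ mul_norm_deriv_le_dist_of_not_mem hf hinj hw hz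

/-- **The inverse of a conformal bijection `f : ℍ → U` is holomorphic with `g' = 1/f'`.** [folklore] -/
theorem hasDerivAt_inv (hf : DifferentiableOn ℂ f upperHalfPlaneSet) (hU : IsOpen U)
    (hgc : ContinuousOn g U) (hgU : MapsTo g U upperHalfPlaneSet)
    (hgf : ∀ w ∈ upperHalfPlaneSet, g (f w) = w) (hfg : ∀ z ∈ U, f (g z) = z) {z : ℂ}
    (hz : z ∈ U) : HasDerivAt g (deriv f (g z))⁻¹ z := by
  have hinj : InjOn f upperHalfPlaneSet := fun w hw w' hw' h ↦ by rw [← hgf w hw, ← hgf w' hw', h]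
  have hgz : g z ∈ upperHalfPlaneSet := hgU hz
  have hfd : HasDerivAt f (deriv f (g z)) (g z) :=
    (hf.differentiableAt (isOpen_upperHalfPlaneSet.mem_nhds hgz)).hasDerivAt
  have hne : deriv f (g z) ≠ 0 :=
    Literature.Analysis.Complex.SCV.deriv_ne_zero_of_injOn hf isOpen_upperHalfPlaneSet hinj hgz
  refine HasDerivAt.of_local_left_inverse ((hgc z hz).continuousAt (hU.mem_nhds hz)) hfd hne ?_
  filter_upwards [hU.mem_nhds hz] with y hy using hfg y hy

/-- **Koebe upper bound for the distance to the boundary**: for a conformal bijection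
`f : ℍ → U` onto an open `U` (continuous inverse `g`) and `w ∈ ℍ`:
`infDist (f w) (ℂ ∖ U) ≤ 4 im w · |f' w|` (Koebe's one-quarter theorem for `g` on the disc
`B(f w, infDist (f w) (ℂ ∖ U)) ⊆ U`: its image contains the disc of radius `infDist/(4 |f' w|)`
about `w`, which must miss the real point `re w`). Lawler (2005), Cor. 3.19 with the constant `4`.
[cite: Lawler2008, Thm. 3.17 (p. 62)] -/
theorem infDist_le_mul_norm_deriv (hf : DifferentiableOn ℂ f upperHalfPlaneSet) (hU : IsOpen U)
    (hfU : MapsTo f upperHalfPlaneSet U) (hgc : ContinuousOn g U)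
    (hgU : MapsTo g U upperHalfPlaneSet) (hgf : ∀ w ∈ upperHalfPlaneSet, g (f w) = w)
    (hfg : ∀ z ∈ U, f (g z) = z) {w : ℂ} (hw : w ∈ upperHalfPlaneSet) :
    infDist (f w) Uᶜ ≤ 4 * w.im * ‖deriv f w‖ := by
  have hwim : 0 < w.im := hw
  rcases eq_or_lt_of_le (infDist_nonneg (x := f w) (s := Uᶜ)) with h0 | hδ0
  · rw [← h0]; positivity
  -- Koebe for `g` on `B(f w, δ) ⊆ U`, `δ = infDist (f w) (ℂ ∖ U)`
  set δ : ℝ := infDist (f w) Uᶜ with hδ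
  have hball : ball (f w) δ ⊆ U := ball_infDist_compl_subset
  have hgd : DifferentiableOn ℂ g (ball (f w) δ) := fun z hz ↦
    (hasDerivAt_inv hf hU hgc hgU hgf hfg (hball hz)).differentiableAt.differentiableWithinAt
  have hginj : InjOn g (ball (f w) δ) := fun z hz z' hz' h ↦ by
    rw [← hfg z (hball hz), ← hfg z' (hball hz'), h]
  have hK := Literature.Probability.RandomPlanarGeometry.ball_subset_image_of_injOn_ball hδ0 hgd hginj
  have hgfw : g (f w) = w := hgf w hw
  have hderiv : deriv g (f w) = (deriv f w)⁻¹ := by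
    have h := (hasDerivAt_inv hf hU hgc hgU hgf hfg (hfU hw)).deriv
    rwa [hgfw] at h
  rw [hgfw, hderiv, norm_inv] at hK
  have hne : deriv f w ≠ 0 := by
    have hinj : InjOn f upperHalfPlaneSet := fun v hv v' hv' h ↦ by rw [← hgf v hv, ← hgf v' hv', h]
    exact Literature.Analysis.Complex.SCV.deriv_ne_zero_of_injOn hf isOpen_upperHalfPlaneSet hinj hw
  have hpos : 0 < ‖deriv f w‖ := norm_pos_iff.2 hne
  -- the disc `B(w, δ/(4 |f' w|))` lies in `ℍ`, hence misses the real point `re w`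
  have hH : ball w (δ * ‖deriv f w‖⁻¹ / 4) ⊆ upperHalfPlaneSet := by
    refine hK.trans ?_
    rintro _ ⟨z, hz, rfl⟩
    exact hgU (hball hz)
  by_contra hcon
  rw [not_le] at hcon
  have hmem : ((w.re : ℝ) : ℂ) ∈ ball w (δ * ‖deriv f w‖⁻¹ / 4) := by
    rw [mem_ball, dist_eq_norm, show ((w.re : ℝ) : ℂ) - w = -((w.im : ℝ) * I) from by
      apply Complex.ext <;> simp, norm_neg, norm_mul, Complex.norm_real, norm_I, mul_one,
      Real.norm_eq_abs, abs_of_pos hwim, lt_div_iff₀ (by norm_num : (0 : ℝ) < 4),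
      ← div_eq_mul_inv, lt_div_iff₀ hpos]
    linarith
  have h0 : (0 : ℝ) < (((w.re : ℝ) : ℂ)).im := hH hmem
  simp at h0

end ConformalKit

/-- **Registered form** (anchor `conformalKit_dist_le_of_hlc_of_dist_le` of stmt-CriticalPhenomena-0746, (K2) modulus form):
for a conformal bijection `f : ℍ → U` (open `U`, continuous inverse `g`, displacement `≤ C₀`), uniform local connectedness
of `ℂ ∖ U` at scale `(ε₁, η)` for boundary points in `B̄(0, X + 1 + C₀)` and a radius `0 < d < 1` with Wolff bound `< ε₁`,
`≤ η` give `dist (f w) (f w') ≤ 2η` for all `w, w' ∈ ℍ`, `‖w‖ ≤ X`, `dist w w' ≤ min (d/4) (η d/(d + 8C₀))`.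
[cite: PommerenkeBBCM1992, Prop. 2.3] -/
theorem conformalKit_dist_le_of_hlc_of_dist_le : ∀ (U : Set ℂ) (f g : ℂ → ℂ) (C₀ ε₁ η X d : ℝ), DifferentiableOn ℂ f UpperHalfPlane.upperHalfPlaneSet → IsOpen U → Set.MapsTo f UpperHalfPlane.upperHalfPlaneSet U → ContinuousOn g U → Set.MapsTo g U UpperHalfPlane.upperHalfPlaneSet → (∀ w ∈ UpperHalfPlane.upperHalfPlaneSet, g (f w) = w) → (∀ z ∈ U, f (g z) = z) → 0 ≤ C₀ → (∀ w ∈ UpperHalfPlane.upperHalfPlaneSet, ‖f w - w‖ ≤ C₀) → 0 ≤ η → (∀ a ∈ frontier U, ∀ b ∈ frontier U, a ∈ Metric.closedBall (0 : ℂ) (X + 1 + C₀) → b ∈ Metric.closedBall (0 : ℂ) (X + 1 + C₀) → dist a b < ε₁ → ∃ σ ⊆ Uᶜ, IsCompact σ ∧ IsPreconnected σ ∧ a ∈ σ ∧ b ∈ σ ∧ σ ⊆ Metric.closedBall a η) → 0 < d → d < 1 → 4 * Real.pi * (1 + C₀) / Real.sqrt (Real.log (1 / d)) < ε₁ → 4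 * Real.pi * (1 + C₀) / Real.sqrt (Real.log (1 / d)) ≤ η → ∀ w ∈ UpperHalfPlane.upperHalfPlaneSet, ∀ w' ∈ UpperHalfPlane.upperHalfPlaneSet, ‖w‖ ≤ X → dist w w' ≤ min (d / 4) (η * d / (d + 8 * C₀)) → dist (f w) (f w') ≤ 2 * η :=
  fun _ _ _ _ _ _ _ _ hf hU hfU hgc hgU hgf hfg hC₀ hC hη0 hlc hd hd1 hε₁ hηd _ hw _ hw' hwX hdist ↦
    ConformalKit.dist_le_of_hlc_of_dist_le hf hU hfU hgc hgU hgf hfg hC₀ hC hη0 hlc hd hd1 hε₁ hηd hw hw' hwX hdist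

end Summit.CriticalPhenomena.CardyFormulaZ2.Cruxes.CardyRigidity.CrossingMartingale
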